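import Mathlib.Algebra.BigOperators.Group.Finset.Basic
import Mathlib.Algebra.Order.BigOperators.Group.Finset
import Mathlib.Tactic.Linarith
import Mathlib.Tactic.NormNum
import Mathlib.Tactic.Ring
import HarnessLib

/-!
# The (0,1) cell of the ι-window, XL: the product ground `B₁ × B₂`, XXVII — THE CORNER XII
# (report [XL] `H2-ZERO-ONE-40.md`): arithmetic shadows of LEMMA ALPHA / COROLLARY (γ)-VOID, LEMMA T-SPLIT, THEOREM SLOPE (the
# superadditive hull and the two-bound), THEOREM PSI-ODD / COROLLARY (β)-PLANAR-VOID, and the (α) cell arithmetic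

Family `hodge`, b2b cell `hweil` (helper of item stmt-HodgeConjecture-2524). Report
`run/shared/lean/b2b/hodge-weil/b2b-hweil-pv1-g52/H2-ZERO-ONE-40.md` ([XL]). Context (the report's words, nothing of them formalised here): in the
five `h′ = 2` cells `(7, d₃, 21, d₃ + 2)`, `d₃ = 8, …, 12` (`B := W′·S/2 = 34 + 4d₃ ∈ {66, …, 82}`, `W′·f′ = 28`, `ρ = 4`) the horizontal part of `D′`
is (α) two ι-fixed one-block S-lines, (β) one ι-fixed two-block S-line, or (γ) one bi-dominant S-curve of S-class `(v, 2)`. (γ): the α-budget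
`28 = W′·f′ = F_S + F_off + Σ v_G m_G` caps `m_G ≤ 14`, against `B = m_h + 2m_G` with `m_h ≤ 22`. (α): for a NON-PLAIN ι-fixed one-block line the layer
divisors split as `D_j = jD₁ + D^t_j` with `D^t` pointwise superadditive, `ℓ_j = deg D^t_j`, and the invariant-socle partial sums of [XXXVIII] LINE-SOCLE
together with the local parity `k^t_2(w)` odd give `ℓ_n ≥ min(6⌊n/3⌋, 2⌊n/2⌋ + 3⌊n/3⌋)` (`x_C = 1`) / `≥ 4⌊n/3⌋` (`x_C = 0`), whence a line alone in
its abelian surface (`ℓ_{m−1} ≤ 38`) has `m ≤ 21` / `≤ 30`. (β): for a PLANAR two-block ι-fixed line `ψ₂ = [x̃]/[t²]` is an odd rational section of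
`K` (#zeros = #poles + 2), so `ℓ₂ ≥ 2`, and with [XXXIX] TWO-BLOCK-CAP's socle `ℓ_n ≥ min(⌊n/2⌋ + 3⌊n/5⌋, 2⌊n/2⌋ + ⌊n/5⌋, 3⌊n/2⌋, ⌊n/2⌋ + 2⌊n/3⌋,
2⌊n/2⌋ + 2⌊n/3⌋) > 56 ≥ 38 + 2m_h` for `n ≥ 56`. The theorems below are the integer arithmetic and the elementary facts about superadditive
sequences. None of them claims geometry. HONEST FRAMING: census work inside the ladder's H2 test ((0,1) cell) on the SPECIAL fourfold `X₀`; nothing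
here is a rung; no case of the Hodge conjecture is proved; no statement of [Markman 2025] / [Perry 2026] / [EdGFS 2025] is used.
-/

-- mandated namespace `Summit.HodgeConjecture.HodgeConjecture.…` (Problem = Summit) trips `linter.dupNamespace`; the lakefile disables it
-- tree-wide (weak option), restated here so stand-alone elaboration is warning-free too.
set_option linter.dupNamespace false

namespace Summit.HodgeConjecture.HodgeConjecture.WeilTypeLadder

section ProductGroundTwentySeven

/-- **[XL] 2.1–2.3 (LEMMA ALPHA, COROLLARY (γ)-VOID).** A bi-dominant S-curve of S-class `(v, h)` has `v ≥ 2` and uses `v·m_G` of the α-budget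
`W′·f′ = 28`: `v·m_G ≤ 28 ⟹ m_G ≤ 14`; with the seven-unit bookkeeping `v·m_G ≤ 14 + 2v ⟹ m_G ≤ 9`. In the five `h′ = 2` cells (`d₃ ≥ 8`):
`m_h + 2m_G ≤ 22 + 28 = 50 < 66 ≤ 34 + 4d₃`. [`Nat.mul_le_mul_right`, `omega`] -/
theorem pg27_alpha_budget :
    (∀ v m : ℕ, 2 ≤ v → v * m ≤ 28 → m ≤ 14) ∧
    (∀ v m : ℕ, 2 ≤ v → v * m ≤ 14 + 2 * v → m ≤ 9) ∧
    (∀ d₃ mh mG : ℕ, 8 ≤ d₃ → mh ≤ 22 → mG ≤ 14 → mh + 2 * mG < 34 + 4 * d₃) := by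
  refine ⟨fun v m hv h => ?_, fun v m hv h => ?_, fun d₃ mh mG h1 h2 h3 => by omega⟩
  · have h2 : 2 * m ≤ v * m := Nat.mul_le_mul_right m hv
    omega
  · have h2 : 2 * m ≤ v * m := Nat.mul_le_mul_right m hv
    have h3 : v * m ≤ 14 + 2 * v := h
    -- (v - 2) m ≤ 14 + ... : for v = 2: 2m ≤ 18; in general v m - 2 v ≤ 14 with v ≥ 2 gives m ≤ 9 via (v)(m - 2) ≤ 14 ⟹ m - 2 ≤ 7
    by_contra hc
    have hm : 10 ≤ m := by omega
    have : v * 10 ≤ v * m := Nat.mul_le_mul_left v hm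
    omega

/-- **[XL] 3.1 (LEMMA T-SPLIT, bookkeeping).** `Σ_{j<m} 2j = m(m − 1)`, hence `Σ_{j<m}(2j + ℓ_j) = m(m + 4) + T` gives `Σ_{j<m} ℓ_j = 5m + T`
(LINE-BUDGET in t-units; stated as `Σ_{j≤m} 2j = m(m + 1)` to stay inside `ℕ`), and PAIRING `ε_{m−1} = 2m + 8 + c₀` reads
`ℓ_{m−1} = ε_{m−1} − 2(m − 1) = 10 + c₀`. [`Finset.sum_range_succ`, `ring`] -/
theorem pg27_tsplit_identities :
    (∀ m : ℕ, (∑ j ∈ Finset.range (m + 1), 2 * j) = m * (m + 1)) ∧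
    (∀ m T S : ℤ, S + m * (m - 1) = m * (m + 4) + T → S = 5 * m + T) ∧
    (∀ m c : ℤ, (2 * m + 8 + c) - 2 * (m - 1) = 10 + c) := by
  refine ⟨fun m => ?_, fun m T S h => by linarith, fun m c => by ring⟩
  induction m with
  | zero => simp
  | succ n ih =>
    rw [Finset.sum_range_succ, ih]
    ring

/-- **[XL] 4.1 (THE SUPERADDITIVE HULL).** For a pointwise layer sequence `k : ℕ → ℕ` with `k 0 = 0` and `k i + k j ≤ k (i + j)` (the
multiplicities of the divisors `D^t_j` at one point): `k` is monotone, `a·k i ≤ k (i·a)`, and `a·k i + b·k j ≤ k (i·a + j·b)`; in particular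
`⌊n/2⌋·k 2 ≤ k n`, `⌊n/3⌋·k 3 ≤ k n`, `⌊n/5⌋·k 5 ≤ k n`. [induction] -/
theorem pg27_superadditive_hull (k : ℕ → ℕ) (hadd : ∀ i j : ℕ, k i + k j ≤ k (i + j)) :
    (∀ i j : ℕ, i ≤ j → k i ≤ k j) ∧
    (∀ i a : ℕ, a * k i ≤ k (i * a)) ∧
    (∀ i j a b : ℕ, a * k i + b * k j ≤ k (i * a + j * b)) ∧
    (∀ n : ℕ, (n / 2) * k 2 ≤ k n ∧ (n / 3) * k 3 ≤ k n ∧ (n / 5) * k 5 ≤ k n) := by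
  have mono : ∀ i j : ℕ, i ≤ j → k i ≤ k j := by
    intro i j hij
    obtain ⟨d, rfl⟩ := Nat.exists_eq_add_of_le hij
    have := hadd i d
    omega
  have pw : ∀ i a : ℕ, a * k i ≤ k (i * a) := by
    intro i a
    induction a with
    | zero => simp
    | succ n ih =>
      have h1 := hadd (i * n) i
      have h2 : i * (n + 1) = i * n + i := by ring
      rw [h2]
      nlinarith
  have two : ∀ i j a b : ℕ, a * k i + b * k j ≤ k (i * a + j * b) := by
    intro i j a b
    have h1 := pw i a
    have h2 := pw j b
    have h3 := hadd (i * a) (j * b)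
    omega
  refine ⟨mono, pw, two, fun n => ⟨?_, ?_, ?_⟩⟩
  · exact le_trans (pw 2 (n / 2)) (mono _ _ (by omega))
  · exact le_trans (pw 3 (n / 3)) (mono _ _ (by omega))
  · exact le_trans (pw 5 (n / 5)) (mono _ _ (by omega))

/-- **[XL] 4.1 (hull values used for the minimising profiles).** With `k` as in `pg27_superadditive_hull`: `k 2 ≥ 1 ∧ k 3 ≥ 1 ⟹ k n ≥ ⌊n/2⌋`;
`k 2 ≥ 2 ∧ k 3 ≥ 3 ⟹ k n ≥ n` for `n ≥ 2` (profile F′); `k 2 ≥ 7 ∧ k 3 ≥ 11 ⟹ k 31 ≥ 113` (the plain minimiser at `n = 31`: `31 = 2·2 + 3·9`);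
`k 2 ≥ 1 ∧ k 5 ≥ 3 ⟹ k 56 ≥ 33` (`56 = 2·3 + 5·10`: the two-block minimiser). [from `pg27_superadditive_hull`] -/
theorem pg27_hull_values (k : ℕ → ℕ) (hadd : ∀ i j : ℕ, k i + k j ≤ k (i + j)) :
    (1 ≤ k 2 → ∀ n : ℕ, n / 2 ≤ k n) ∧
    (2 ≤ k 2 → 3 ≤ k 3 → ∀ n : ℕ, 2 ≤ n → n ≤ k n) ∧
    (7 ≤ k 2 → 11 ≤ k 3 → 113 ≤ k 31) ∧
    (1 ≤ k 2 → 3 ≤ k 5 → 33 ≤ k 56) := by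
  obtain ⟨mono, pw, two, fl⟩ := pg27_superadditive_hull k hadd
  refine ⟨fun h2 n => ?_, fun h2 h3 n hn => ?_, fun h2 h3 => ?_, fun h2 h5 => ?_⟩
  · have := (fl n).1
    nlinarith
  · -- n = 2a + 3b with (a, b) = ((n - 3 (n % 2)) / 2, n % 2)
    have key := two 2 3 ((n - 3 * (n % 2)) / 2) (n % 2)
    have hdecomp : 2 * ((n - 3 * (n % 2)) / 2) + 3 * (n % 2) = n := by omega
    rw [hdecomp] at key
    have ha : ((n - 3 * (n % 2)) / 2) * k 2 ≥ ((n - 3 * (n % 2)) / 2) * 2 := Nat.mul_le_mul_left _ h2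
    have hb : (n % 2) * k 3 ≥ (n % 2) * 3 := Nat.mul_le_mul_left _ h3
    omega
  · have key := two 2 3 2 9
    norm_num at key
    omega
  · have key := two 2 5 3 10
    norm_num at key
    omega

/-- **[XL] 4.2 (THEOREM SLOPE (a), the two-bound: combinatorial core).** Non-plain ι-fixed one-block line, t-units, aggregates
`(e₂, f₂, e₃, f₃)` with `0 ≤ f₂ ≤ e₂`, `0 ≤ f₃ ≤ min(6, e₃)`, `e₂ ≤ e₃` and the LINE-SOCLE partial sums `S₂ = 2 − e₂ + f₂`, `S₃ = S₂ + 8 − e₃ − f₃`.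
`x_C = 1` (`S₂, S₃ ≤ 0`): `e₂ ≥ 2`, and `e₃ ≤ 5 ⟹ f₃ − f₂ ≥ 5 − e₂`. `x_C = 0` (`S₂, S₃ ≤ 2`): `e₃ ≤ 3 ⟹ e₂ ≥ 2 ∧ f₃ − f₂ ≥ 5 − e₂`. [`omega`] -/
theorem pg27_two_bound_core :
    (∀ e₂ f₂ e₃ f₃ : ℤ, 0 ≤ f₂ → f₂ ≤ e₂ → 0 ≤ f₃ → f₃ ≤ e₃ → f₃ ≤ 6 →
        2 - e₂ + f₂ ≤ 0 → (2 - e₂ + f₂) + (8 - e₃ - f₃) ≤ 0 → 2 ≤ e₂ ∧ (e₃ ≤ 5 → 5 - e₂ ≤ f₃ - f₂)) ∧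
    (∀ e₂ f₂ e₃ f₃ : ℤ, 0 ≤ f₂ → f₂ ≤ e₂ → 0 ≤ f₃ → f₃ ≤ e₃ → f₃ ≤ 6 → e₂ ≤ e₃ →
        2 - e₂ + f₂ ≤ 2 → (2 - e₂ + f₂) + (8 - e₃ - f₃) ≤ 2 → (e₃ ≤ 3 → 2 ≤ e₂ ∧ 5 - e₂ ≤ f₃ - f₂)) := by
  refine ⟨fun e₂ f₂ e₃ f₃ h1 h2 h3 h4 h5 h6 h7 => ⟨by omega, fun h8 => by omega⟩,
    fun e₂ f₂ e₃ f₃ h1 h2 h3 h4 h5 h6 h7 h8 h9 => ⟨by omega, by omega⟩⟩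

/-- **[XL] 4.2 (THEOREM SLOPE (a), the two-bound: the products).** With `A = ⌊n/2⌋ ≥ B = ⌊n/3⌋ ≥ 0`: if `e₂ ≥ 2` and `g ≥ 0`, `g ≥ 5 − e₂`
(`g = (f₃ − f₂)⁺` from the core) then `A·e₂ + B·g ≥ 2A + 3B`; if `e₃ ≥ 6` then `B·e₃ ≥ 6B`; if `e₃ ≥ 4` then `B·e₃ ≥ 4B`; and `2A + 3B ≥ 4B` (`B ≥ 0`).
Hence `ℓ_n ≥ min(6⌊n/3⌋, 2⌊n/2⌋ + 3⌊n/3⌋)` (`x_C = 1`) and `ℓ_n ≥ 4⌊n/3⌋` (`x_C = 0`). [`nlinarith`] -/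
theorem pg27_two_bound_products :
    (∀ A B e₂ g : ℤ, 0 ≤ B → B ≤ A → 2 ≤ e₂ → 0 ≤ g → 5 - e₂ ≤ g → 2 * A + 3 * B ≤ A * e₂ + B * g) ∧
    (∀ B e₃ : ℤ, 0 ≤ B → 6 ≤ e₃ → 6 * B ≤ B * e₃) ∧
    (∀ B e₃ : ℤ, 0 ≤ B → 4 ≤ e₃ → 4 * B ≤ B * e₃) ∧
    (∀ A B : ℤ, 0 ≤ B → B ≤ A → 4 * B ≤ 2 * A + 3 * B) := by
  refine ⟨fun A B e₂ g hB hBA he hg hge => ?_, fun B e₃ hB he => by nlinarith, fun B e₃ hB he => by nlinarith,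
    fun A B h0 h => by linarith⟩
  rcases le_or_gt 5 e₂ with h5 | h5
  · nlinarith [mul_nonneg hB hg, mul_le_mul_of_nonneg_left h5 (le_trans hB hBA)]
  · nlinarith [mul_le_mul_of_nonneg_left hge hB, mul_nonneg (sub_nonneg.mpr hBA) (by linarith : (0:ℤ) ≤ e₂ - 2)]

/-- **[XL] 4.3 (COROLLARY LINE-CAP♯, hand version) and 6.1 ((α) cell arithmetic).** From `ℓ_{m−1} ≥ min(6⌊(m−1)/3⌋, 2⌊(m−1)/2⌋ + 3⌊(m−1)/3⌋)`
(`x_C = 1`) resp. `≥ 4⌊(m−1)/3⌋` (`x_C = 0`) and `ℓ_{m−1} = 10 + c₀ ≤ 38` (alone in `P_z`) resp. `≤ 38 + 2m_h` with `m_h ≤ 9` (at `z_i`, non-plain):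
`m ≤ 21` / `m ≤ 30` / `m ≤ 30`; the plain caps `15 / 19` of [XXXIX] LINE-CAP (b). Cells: (α0) `30 + 30 < 66`; (α1) `5 + 21 + 21 < 66`;
(α2-np) `9 + 30 + 21 < 66`; all against `B = 34 + 4d₃ ≥ 66`. [`omega`] -/
theorem pg27_line_cap_sharp :
    (∀ m : ℤ, 3 ≤ m → (6 * ((m - 1) / 3) ≤ 38 ∨ 2 * ((m - 1) / 2) + 3 * ((m - 1) / 3) ≤ 38) → m ≤ 21) ∧
    (∀ m : ℤ, 3 ≤ m → 4 * ((m - 1) / 3) ≤ 38 → m ≤ 30) ∧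
    (∀ m mh : ℤ, 3 ≤ m → mh ≤ 9 → (6 * ((m - 1) / 3) ≤ 38 + 2 * mh ∨ 2 * ((m - 1) / 2) + 3 * ((m - 1) / 3) ≤ 38 + 2 * mh) → m ≤ 30) ∧
    (∀ d₃ m₁ m₂ mh : ℤ, 8 ≤ d₃ → m₁ ≤ 30 → m₂ ≤ 30 → mh ≤ 9 →
        m₁ + m₂ < 34 + 4 * d₃ ∧ 5 + 21 + 21 < 34 + 4 * d₃ ∧ mh + 30 + 21 < 34 + 4 * d₃) := by
  refine ⟨fun m hm h => by omega, fun m hm h => by omega, fun m mh hm hmh h => by omega, fun d₃ m₁ m₂ mh h1 h2 h3 h4 => by omega⟩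

/-- **[XL] 5.1–5.2 (THEOREM PSI-ODD and THEOREM PLAIN's count).** A rational section of a degree-2 bundle with `Z` zeros and `P_tot` poles has
`Z = P_tot + 2`; if every one of the six Weierstrass points is a zero or a pole, with `P_W` of them poles, then `Z ≥ 6 − P_W` and `P_tot ≥ P_W`, so
`P_tot ≥ max(P_W, 4 − P_W) ≥ 2`, with `P_tot = 2` only for `P_W = 2`. The degree-(−4) version ([XXXIX] PLAIN): `Z = P_tot − 4`, hence `P_tot ≥ 10 − P_W`,
and with LINE-SOCLE's `P_tot ≥ 6 + P_W` (`x_C = 1`): `P_tot ≥ 8`. [`omega`] -/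
theorem pg27_psi_odd_count :
    (∀ Z P PW : ℤ, 0 ≤ PW → PW ≤ 6 → PW ≤ P → Z = P + 2 → 6 - PW ≤ Z → 2 ≤ P ∧ 4 - PW ≤ P ∧ (P = 2 → PW = 2)) ∧
    (∀ Z P PW : ℤ, 0 ≤ PW → PW ≤ 6 → PW ≤ P → Z = P - 4 → 6 - PW ≤ Z → 6 + PW ≤ P → 8 ≤ P) := by
  refine ⟨fun Z P PW h1 h2 h3 h4 h5 => ⟨by omega, by omega, fun h => by omega⟩, fun Z P PW h1 h2 h3 h4 h5 h6 => by omega⟩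

/-- **[XL] 5.3–5.4 (TWO-BLOCK-CAP♯, COROLLARY (β)-PLANAR-VOID).** (a) The socle step: `(ε₄, f₄, ε₅, f₅) = (4, 0, 4, 0)` violates
`S₅ = (2 − ε₄ + f₄) + (8 − ε₅ − f₅) ≤ 0`, so with `D^t_2 = w_a + w_b` and `D^t_5` supported on `{w_a, w_b}` one of `k₅(w_a), k₅(w_b)` is `≥ 3`.
(b) The hand bound `ℓ_n ≥ min(⌊n/2⌋ + 3⌊n/5⌋, 2⌊n/2⌋ + ⌊n/5⌋, 3⌊n/2⌋, ⌊n/2⌋ + 2⌊n/3⌋, 2⌊n/2⌋ + 2⌊n/3⌋)` exceeds `56 ≥ 38 + 2m_h` (`m_h ≤ 9`)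
for every `n ≥ 56` (all survivors of [XXXIX] 13.2 (ii) have `m − 1 ≥ 56`), and is `≤ 38` only for `n ≤ 35` (alone in `P_z`: `m ≤ 36`);
`2⌊n/2⌋ ≤ 38 ⟹ n ≤ 39` (`x_C = 0`: `m ≤ 40`). [`omega`] -/
theorem pg27_beta_planar_void :
    (¬ ((2 - (4:ℤ) + 0) + (8 - 4 - 0) ≤ 0)) ∧
    (∀ n mh : ℤ, 56 ≤ n → mh ≤ 9 →
        38 + 2 * mh < n / 2 + 3 * (n / 5) ∧ 38 + 2 * mh < 2 * (n / 2) + n / 5 ∧ 38 + 2 * mh < 3 * (n / 2) ∧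
        38 + 2 * mh < n / 2 + 2 * (n / 3) ∧ 38 + 2 * mh < 2 * (n / 2) + 2 * (n / 3)) ∧
    (∀ n : ℤ, 2 ≤ n → (n / 2 + 3 * (n / 5) ≤ 38 ∨ 2 * (n / 2) + n / 5 ≤ 38 ∨ 3 * (n / 2) ≤ 38 ∨ n / 2 + 2 * (n / 3) ≤ 38 ∨
        2 * (n / 2) + 2 * (n / 3) ≤ 38) → n ≤ 35) ∧
    (∀ n : ℤ, 2 ≤ n → 2 * (n / 2) ≤ 38 → n ≤ 39) := by
  refine ⟨by omega, fun n mh hn hmh => ⟨by omega, by omega, by omega, by omega, by omega⟩, fun n hn h => by omega,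
    fun n hn h => by omega⟩

/-- **[XL] 7.2 (what remains of the five `h′ = 2` cells).** With (γ), (β)-planar and (α) excluded, a (0,1) object of a cell `(7, d₃, 21, d₃ + 2)`,
`d₃ = 8, …, 12`, carries one ι-fixed THICK two-block S-line of multiplicity `m = B − m_h`; `m_h ≤ 5` off `z_i` (P-CAP (o)), `m_h ≤ 18` at `z_i`
with `ν = 2` (P-CAP (ii)), `m_h ≤ 22` always (THETA-CAP): `m ≥ B − 22 ≥ 44`, and `m ≥ 61` off `z_i`. [`omega`] -/
theorem pg27_thick_residual_window :
    ∀ d₃ mh : ℤ, 8 ≤ d₃ → d₃ ≤ 12 → 0 ≤ mh → mh ≤ 22 →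
      44 ≤ 34 + 4 * d₃ - mh ∧ (mh ≤ 5 → 61 ≤ 34 + 4 * d₃ - mh) ∧ 34 + 4 * d₃ ≤ 82 := by
  intro d₃ mh h1 h2 h3 h4
  exact ⟨by omega, fun h => by omega, by omega⟩

end ProductGroundTwentySeven

end Summit.HodgeConjecture.HodgeConjecture.WeilTypeLadder
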